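import Summits.BirchSwinnertonDyer.BirchSwinnertonDyer.Theorems.GenusKolyvaginAtTwoK1NegSuHalvesStarFrameObstruction
import Summits.BirchSwinnertonDyer.BirchSwinnertonDyer.Theorems.GenusKolyvaginAtTwoPowDvdShaCardAtTwoRTRestrictionKernelIndexTwo
import Summits.BirchSwinnertonDyer.BirchSwinnertonDyer.Theorems.GenusKolyvaginAtTwoCasselsTatePairingRat
import Summits.BirchSwinnertonDyer.BirchSwinnertonDyer.Theorems.GoldfeldAllTwistsTwoConverseTwinGordPlacement
import Literature.NumberTheory.EllipticCurves.BSDInvariantsProofs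
import HarnessLib

/-!
# Route `GenusKolyvaginAtTwo`, cruxes K₁⁺ `K1Pos` (stmt-BirchSwinnertonDyer-31468) / K₁⁻ `K1Neg` (31525), LINES 31/30 «su_halves»:
# THE SWAPPED GROSS–ZAGIER LEDGER IS TAMAGAWA-FREE ON THE RANK-ZERO SIDE — stub B2′ `stub_swappedLedger` re-read and its
# `t′`-free form B2″ PROVED modulo the route's four print items

Seat `bsd-line-gk2-p3` g32 (PROVER seat 3/3, cell `bsd-f1-sign2`), `--supports stmt-BirchSwinnertonDyer-31468` (helper; closes nothing);
sequel of `…K1NegSuHalvesStarFrameObstruction` (p781564).  THEOREMS ONLY (no definition, no named fact, no `sorry`); standard axioms.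
**BSD is NOT proved by this file; K1Pos / K1Neg are NOT proved; no item is closed.**  §1–§2 are CONDITIONAL (D-0014) on the four STATEMENT-ONLY
published facts the route carries as items (`GrossZagierAllLevels` 24148, `MultPublishedInputsAtTwo` 19921, `EntireLFunctionRat` 19273,
`MilneAnyModel` 24149) — displayed as hypotheses, exactly as in the pen's stub B2′; §0 is unconditional.

THE POINT.  LINE 31 (`Cruxes/K1Pos/Lines/su_halves.lean`, mirror of LINE 30) proves the rank-one half B of K₁⁺ from B1′ (a Kriz–Li (★)-frame
`K'` for the twin `Wd`, with `P' = y_(K') ∉ 2·Wd(K')` by Lemma 5.4), B2′ `stub_swappedLedger` and B3 `stub_rankZeroIntegrality`.  B2′ as REGISTERED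
asserts, for the rank-`0` partner `W' ≅ Wd^(d_K')` with `#Ш_an(W') = q'`, that `ord₂ #Ш_an(Wd) + ord₂ q' + ord₂ C(W') ≤ 0`.  This file computes the
swapped Gross–Zagier–Milne ledger EXACTLY (§1) and finds it TAMAGAWA-FREE on the partner's side:

* §0 over `K = ℚ(√d_K)` every `ℚ`-model of `E^(d_K)` is a `K`-change of variables of `E_K` (tree `GoldfeldGoodTwists.exists_smul_baseChange_eq_baseChange_model_twist`),
  so (`sha_rank_torsion_baseChange_twist`) `#Ш`, finiteness, rank and `2`-torsion-freeness agree for `(Wd)_K` and `E_K`;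
  **`padicValNat_shaOrder_twist_le`** — for `rank E(K) = 1`, `E(K)[2] = 0`: **`ord₂ #Ш(Wd/ℚ) ≤ ord₂ #Ш(E_K)`** (the kernel of
  `Ш(Wd) → Ш((Wd)_K) ≅ Ш(E_K)` has order `≤ 2^(rank) = 2` by my lineage's g16 `natCard_ker_shaRestriction_le_two_pow_mordellWeilRank` — Kramer's
  inflated `H¹(Gal(K/ℚ), Wd(K))` — the image is a subgroup, and both orders are squares by Cassels–Tate, unconditional in the tree).
* §1 **`swappedLedger`** — `W` rank-`1` with `#Sel₂ = 2` carrying the Heegner frame (`K` odd-`d_K ≠ −3` Heegner, ANY datum, `P₀ = y_K` of infinite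
  order, `I = [E(K):ℤP₀]`), `Wd` ANY globally minimal twin with `#Ш_an(Wd) = qd`: `#Ш_an(E) = qW ∈ ℚ` and
  **`ord₂ qW + ord₂ qd + ord₂ #Ш(E_K) = 2 ord₂ I − 2 ord₂ c − 2 ord₂ C(E) + ord₂ #Ш(E) + ord₂ #Ш(Wd)`** (`ord₂ #Ш(E) = 0`).  Gross–Zagier over `K`
  (`#Ш_an(E_K) = 4I²/(c²w²C(E)²)`) × Milne's defect additivity.  The partner's Tamagawa product `C(Wd)` does NOT occur.
* §2 **`swappedLedger_tfree`** = B2″: with `c` odd and `P₀ ∉ 2E(K)`: **`ord₂ qW + ord₂ qd ≤ −2 ord₂ C(E) ≤ 0`** — stub B2′ WITHOUT the term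
  `+ ord₂ C(W')`, PROVED modulo the four print facts (read `W ↦ Wd`, `K ↦ K'`, `Wd ↦ W'`, `qd ↦ q'` to land on LINE 31's binders; only `r_an(Wd) = 1`,
  `#Sel₂(Wd) = 2`, the K′-frame and `hnd` are used).  `swappedLedger_asTyped_of_tamagawa_le` — B2′'s typed conclusion follows iff additionally
  `ord₂ C(W') ≤ 2 ord₂ C(Wd)`; on K₁⁺ (`C(Wd)` odd) that is `ord₂ C(W') = 0`: every prime of `d_(K')` SILENT for `Wd`.  At an auxiliary frame with a
  transposition / identity prime, B2′ as typed claims more than the ledger (under `BSD₂(Wd) ∧ BSD₂(W')` it would force `ord₂ C(W') = 0`).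
  REPAIR for the pen (one of): (a) B2′ ↦ B2″ and B3 ↦ B3♯ «`0 ≤ ord₂ #Ш_an(W')`» (the composition `rankOneHalf_of_swap` then closes by `omega` as
  before); or (b) keep B2′/B3 and add «every prime of `d_(K')` is silent for `Wd`» to B1′'s frame (Kriz–Li's `𝒩` consists of silent primes anyway).
  On K₁⁻ (LINE 30) B2″ gives `≤ −2` — consistent with p781564: there the (★)-frame itself is refuted modulo the leaf.

HONEST FRAMING: valuation bookkeeping over landed theorems; beyond-print inputs displayed; nothing about BSD is proved.  References:
[GrossZagier1986] I.(6.3), V.§2 (2.2); [GrossLMS1991] §2 (2.2); [Milne1972ArithmeticAV] §1 Thm. 1; [Kramer1981] proof of Thm. 2; [KrizLi2019] Lemma 5.4;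
[SilvermanAEC2009] X.4.14, X.5 Cor. 5.4; [Miller2011LMS] Def. 1.1.
-/

set_option autoImplicit false
set_option linter.dupNamespace false -- `Summit.<P>.<Sub>` repeats `BirchSwinnertonDyer` (D-0017)

noncomputable section

open scoped Classical

open WeierstrassCurve NumberField Literature.NumberTheory.EllipticCurves Literature.NumberTheory.EllipticCurves.ModularForms
  Literature.NumberTheory.EllipticCurves.Rank1Residual Literature.NumberTheory.EllipticCurves.Rank1Residual.Typed
  Literature.NumberTheory.EllipticCurves.KrizLi2019
  Summit.BirchSwinnertonDyer.Rank1Residual Summit.BirchSwinnertonDyer.Rank1Residual.AdditivePotMult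
  Summit.BirchSwinnertonDyer.BirchSwinnertonDyer.Rank1Residual Summit.BirchSwinnertonDyer.BirchSwinnertonDyer.Theses.GenusKolyvaginAtTwo
  Summit.BirchSwinnertonDyer.BirchSwinnertonDyer.Theorems.CMExactDescent Summit.BirchSwinnertonDyer.BirchSwinnertonDyer.Theorems.GenusExact.TwinSwap

namespace Summit.BirchSwinnertonDyer.BirchSwinnertonDyer.Theorems.GenusExact.SuHalves.SwappedLedger

open Summit.BirchSwinnertonDyer.BirchSwinnertonDyer.Theorems.GenusExact.PlusDescent (natCard_ker_shaRestriction_le_two_pow_mordellWeilRank)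
open Summit.BirchSwinnertonDyer.BirchSwinnertonDyer.Theorems.GoldfeldGoodTwists (exists_smul_baseChange_eq_baseChange_model_twist)

/-! ## §0 Over `K = ℚ(√d_K)` every model of the twist is a `K`-change of variables of `E_K`; consequences for `Ш` -/

/-- **Consequences for `Ш`, rank and `2`-torsion over `K`.**  In the same setting: `#Ш((Wd)_K) = #Ш(E_K)`, `Ш((Wd)_K)` finite iff `Ш(E_K)` is,
`rank Wd(K) = rank E(K)`, and `Wd(K)[2] = 0` iff `E(K)[2] = 0` (transport along the change of variables). [cite: SilvermanAEC2009, X.§4 and III.3.1(b)] -/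
theorem sha_rank_torsion_baseChange_twist (W : WeierstrassCurve ℚ) (K : Type) [Field K] [NumberField K]
    (h2 : Module.finrank ℚ K = 2) (Wd : WeierstrassCurve ℚ)
    (hWd : ∃ C : VariableChange ℚ, C • W.quadraticTwist (NumberField.discr K : ℚ) = Wd) :
    (Wd.baseChange K).shaOrder = (W.baseChange K).shaOrder ∧
      ((Wd.baseChange K).ShaFinite ↔ (W.baseChange K).ShaFinite) ∧
      (Wd.baseChange K).mordellWeilRank = (W.baseChange K).mordellWeilRank ∧
      ((∀ P : (W.baseChange K).toAffine.Point, 2 • P = 0 → P = 0) →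
        ∀ P : (Wd.baseChange K).toAffine.Point, 2 • P = 0 → P = 0) := by
  obtain ⟨V, hV⟩ := exists_smul_baseChange_eq_baseChange_model_twist W K h2 Wd hWd
  refine ⟨?_, ?_, ?_, fun hT P hP ↦ ?_⟩
  · rw [← hV]; exact shaOrder_variableChange_holds (W.baseChange K) V
  · rw [← hV]; exact shaFinite_variableChange_iff_holds (W.baseChange K) V
  · rw [← hV]; exact mordellWeilRank_variableChange_holds (W.baseChange K) V
  · have e : (W.baseChange K).toAffine.Point ≃+ (Wd.baseChange K).toAffine.Point :=
      (VariableChange.pointEquiv (W.baseChange K) V).trans (WeierstrassCurve.Affine.Point.congrEquiv hV)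
    have h0 : e.symm P = 0 := hT _ (by rw [← map_nsmul, hP, map_zero])
    simpa using congrArg e h0


/-- **The restriction count for the twin: `ord₂ #Ш(Wd/ℚ) ≤ ord₂ #Ш(E_K)`.**  `W/ℚ` elliptic, `[K:ℚ] = 2`, `Wd` any elliptic `ℚ`-model of
`W^(d_K)`, with `rank E(K) = 1`, `E(K)[2] = 0`, `Ш(Wd/ℚ)` and `Ш(E_K)` finite.  Then `ord₂ #Ш(Wd) ≤ ord₂ #Ш(E_K)`: the kernel of
`Ш(Wd/ℚ) → Ш((Wd)_K) ≅ Ш(E_K)` has order `≤ 2^{rank Wd(K)} = 2` (g16 `natCard_ker_shaRestriction_le_two_pow_mordellWeilRank`: Kramer's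
inflated `H¹(Gal(K/ℚ), Wd(K))`), the image is a subgroup, and both orders are squares (Cassels–Tate, unconditional in the tree), so the odd
bound `≤ 1 + ord₂ #Ш(E_K)` improves to `≤ ord₂ #Ш(E_K)`.  [cite: Kramer1981, proof of Thm. 2] [cite: SilvermanAEC2009, Thm. X.4.14] -/
theorem padicValNat_shaOrder_twist_le (W : WeierstrassCurve ℚ) [W.IsElliptic] (K : Type) [Field K] [NumberField K]
    (h2 : Module.finrank ℚ K = 2) (Wd : WeierstrassCurve ℚ) [Wd.IsElliptic]
    (hWd : ∃ C : VariableChange ℚ, C • W.quadraticTwist (NumberField.discr K : ℚ) = Wd)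
    (hrkK : (W.baseChange K).mordellWeilRank = 1) (h2K : ∀ P : (W.baseChange K).toAffine.Point, 2 • P = 0 → P = 0)
    (hfinD : Wd.ShaFinite) (hfinK : (W.baseChange K).ShaFinite) :
    padicValNat 2 Wd.shaOrder ≤ padicValNat 2 (W.baseChange K).shaOrder := by
  haveI : Fact (Nat.Prime 2) := ⟨Nat.prime_two⟩
  haveI : Algebra.IsQuadraticExtension ℚ K := ⟨h2⟩
  haveI : IsGalois ℚ K := inferInstance
  haveI hEdK : (Wd.baseChange K).IsElliptic := isElliptic_baseChange' Wd K
  obtain ⟨hsha, hfin, hrk, htor⟩ := sha_rank_torsion_baseChange_twist W K h2 Wd hWd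
  have hfinDK : (Wd.baseChange K).ShaFinite := hfin.mpr hfinK
  haveI : Finite Wd.sha := hfinD
  haveI : Finite (Wd.baseChange K).sha := hfinDK
  -- the kernel has order `≤ 2`, the image divides `#Ш((Wd)_K) = #Ш(E_K)`
  have hker : Nat.card (shaRestriction Wd K).ker ≤ 2 := by
    have h := natCard_ker_shaRestriction_le_two_pow_mordellWeilRank Wd K h2 (htor h2K)
    rwa [hrk, hrkK, pow_one] at h
  have hker0 : Nat.card (shaRestriction Wd K).ker ≠ 0 := Nat.card_pos.ne'
  have hprod : Wd.shaOrder = Nat.card (shaRestriction Wd K).ker * Nat.card (shaRestriction Wd K).range := by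
    rw [WeierstrassCurve.shaOrder, AddSubgroup.card_eq_card_quotient_mul_card_addSubgroup (shaRestriction Wd K).ker,
      Nat.card_congr (QuotientAddGroup.quotientKerEquivRange (shaRestriction Wd K)).toEquiv, mul_comm]
  have hdvd : Nat.card (shaRestriction Wd K).range ∣ (W.baseChange K).shaOrder := by
    rw [← hsha, WeierstrassCurve.shaOrder]
    exact AddSubgroup.card_addSubgroup_dvd_card _
  have hrange0 : Nat.card (shaRestriction Wd K).range ≠ 0 := Nat.card_pos.ne'
  have hK0 : (W.baseChange K).shaOrder ≠ 0 := ((W.baseChange K).shaOrder_pos hfinK).ne'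
  have hle1 : padicValNat 2 Wd.shaOrder ≤ 1 + padicValNat 2 (W.baseChange K).shaOrder := by
    rw [hprod, padicValNat.mul hker0 hrange0]
    have hk : padicValNat 2 (Nat.card (shaRestriction Wd K).ker) ≤ 1 := by
      rcases (show Nat.card (shaRestriction Wd K).ker = 1 ∨ Nat.card (shaRestriction Wd K).ker = 2 by omega) with h | h
      · rw [h]; simp
      · rw [h]; simp
    have hr : padicValNat 2 (Nat.card (shaRestriction Wd K).range) ≤ padicValNat 2 (W.baseChange K).shaOrder :=
      (padicValNat_dvd_iff_le hK0).mp (dvd_trans pow_padicValNat_dvd hdvd)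
    omega
  -- both orders are squares (Cassels–Tate, unconditional in the tree), so both valuations are even
  have hev : ∀ {n : ℕ}, n ≠ 0 → IsSquare n → Even (padicValNat 2 n) := fun {n} hn hsq ↦ by
    obtain ⟨r, rfl⟩ := hsq
    have hr : r ≠ 0 := fun h ↦ hn (by rw [h, mul_zero])
    rw [padicValNat.mul hr hr]
    exact ⟨_, rfl⟩
  obtain ⟨a, ha⟩ := hev (Wd.shaOrder_pos hfinD).ne' (WeierstrassCurve.isSquare_shaOrder_of_shaFinite Wd hfinD)
  obtain ⟨b, hb⟩ := hev hK0 (WeierstrassCurve.isSquare_shaOrder_of_shaFinite (W.baseChange K) hfinK)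
  omega

/-! ## §1 The exact swapped Gross–Zagier–Milne ledger -/

/-- **In a rank-one group without `2`-torsion, `2 ∣ [A : ℤP]` makes `P` `2`-divisible.** [folklore] -/
theorem exists_two_zsmul_eq_of_one_le_padicValNat_index {F : Type} [Field F] [NumberField F] (V : WeierstrassCurve F) [V.IsElliptic]
    (hrk : V.mordellWeilRank = 1) (hiv : ∀ x : V.toAffine.Point, 2 • x = 0 → x = 0)
    (P₀ : V.toAffine.Point) (hPinf : ¬ IsOfFinAddOrder P₀) (hI : 1 ≤ padicValNat 2 (AddSubgroup.zmultiples P₀).index) :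
    ∃ R : V.toAffine.Point, (2 : ℤ) • R = P₀ := by
  haveI : Fact (Nat.Prime 2) := ⟨Nat.prime_two⟩
  haveI : Finite (AddCommGroup.torsion V.toAffine.Point) := WeierstrassCurve.finite_torsion_point (W := V)
  obtain ⟨c, Q, hcQ, hcker⟩ := X11b.RankOne.exists_coord_of_mordellWeilRank_eq_one V hrk
  have hcP : c P₀ ≠ 0 := fun h0 ↦ hPinf (hcker P₀ h0)
  rw [X11b.RankOne.padicValNat_index_zmultiples_eq c Q hcQ hcker hiv P₀ hcP] at hI
  have h2c : 2 ^ 1 ∣ (c P₀).natAbs := (padicValNat_dvd_iff_le (Int.natAbs_ne_zero.mpr hcP)).mpr hI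
  obtain ⟨a, ha⟩ := Int.ofNat_dvd_left.mpr h2c
  have ht : IsOfFinAddOrder (P₀ - c P₀ • Q) := X11b.RankOne.isOfFinAddOrder_sub_coord_zsmul c Q hcQ hcker P₀
  obtain ⟨t', ht'⟩ := X11b.LocalIndex.mem_range_nsmul_pow_of_isOfFinAddOrder hiv 1 ht
  have ht'' : (2 ^ 1) • t' = P₀ - c P₀ • Q := by rw [← nsmulAddMonoidHom_apply]; exact ht'
  have hdivK : ∃ R : V.toAffine.Point, ((2 ^ 1 : ℕ) : ℤ) • R = P₀ := by
    refine ⟨a • Q + t', ?_⟩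
    rw [smul_add, smul_smul, ← ha, natCast_zsmul, ht'']
    abel
  obtain ⟨R, hR⟩ := hdivK
  exact ⟨R, by simpa using hR⟩

/-- **THE EXACT SWAPPED GROSS–ZAGIER–MILNE LEDGER.**  `W/ℚ` globally minimal of analytic rank `1` with `#Sel₂(E) = 2` (the rank-ONE curve carries
the Heegner frame — the «swapped» orientation of LINES 30/31); `K` imaginary quadratic with odd `d_K ≠ −3`, Heegner for `N_E`; ANY datum `Dt`
(`Dt.c ≠ 0`), `d₁` conductor-`1`, `P₀ ∈ E(K)` of infinite order mapping to `P(1)`, `I = [E(K) : ℤP₀]`; `Wd` ANY globally minimal model of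
`E^(d_K)` with `#Ш_an(Wd) = qd ∈ ℚ`.  Modulo the four PRINT facts (Gross–Zagier, GZK, modularity, Milne any-model): `Ш(E)`, `Ш(Wd)`, `Ш(E_K)`
are finite, `rank E(K) = 1`, `E(K)[2] = 0`, `r_an(Wd) = 0`, `ord₂ #Ш(E) = 0`, and `#Ш_an(E) = qW ∈ ℚ` with
**`ord₂ qW + ord₂ qd + ord₂ #Ш(E_K) = 2·ord₂ I − 2·ord₂ c − 2·ord₂ C(E) + ord₂ #Ш(E) + ord₂ #Ш(Wd)`**
(Gross–Zagier over `K`: `#Ш_an(E_K) = 4I²/(c² w_K² C(E)²)`, `w_K = 2` — tree `CMExactDescent.shaAnOverC_baseChange_eq_of_heegner`; Milne's defect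
additivity `#Ш_an(E_K)·#Ш(E)·#Ш(Wd) = #Ш_an(E)·#Ш_an(Wd)·#Ш(E_K)` — tree `AdditivePotMult.shaAnOverC_mul_eq` with the named fact).  NO Tamagawa
number of the twin `Wd` enters.  CONDITIONAL on the four named facts; nothing about BSD is proved.
[cite: GrossZagier1986, I.(6.3), V.§2 (2.2)] [cite: GrossLMS1991, §2 (2.2)] [cite: Milne1972ArithmeticAV, §1 Thm. 1] [cite: Miller2011LMS, Def. 1.1] -/
theorem swappedLedger
    (W : WeierstrassCurve ℚ) [W.IsElliptic] [W.IsGloballyMinimal] [NeZero (W.conductorNorm ℤ)]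
    (K : Type) [Field K] [NumberField K]
    (hGZ : gross_zagier (W.conductorNorm ℤ) W K) (hGZK : rank_eq_analyticRank_of_analyticRank_le_one)
    (hmod : hasEntireLFunction_rat) (hMilneC : Milne1972.bsdQuotient_baseChange_quadratic_anyModel)
    (hr : W.analyticRank = 1) (hSel : Nat.card (W.selmerGroup 2) = 2)
    (hK : IsImaginaryQuadratic K) (hodd : Odd (NumberField.discr K)) (h3 : NumberField.discr K ≠ -3)
    (hH : SatisfiesHeegnerHypothesis (W.conductorNorm ℤ) K)
    (Dt : ModularParametrizationData W (W.conductorNorm ℤ)) (hc0 : Dt.c ≠ 0) (β : ℤ) (ι : K →+* ℂ)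
    (d₁ : KolyvaginHeegnerData Dt β ι 1) (P₀ : (W.baseChange K).toAffine.Point)
    (hP₀K : WeierstrassCurve.Affine.Point.map (W' := W) (algebraMap K (ringClassField K ι 1)).toRatAlgHom P₀ = d₁.derivedPoint)
    (hPinf : ¬ IsOfFinAddOrder P₀)
    (Wd : WeierstrassCurve ℚ) [Wd.IsElliptic] [Wd.IsGloballyMinimal]
    (hWd : ∃ C : VariableChange ℚ, C • W.quadraticTwist (NumberField.discr K : ℚ) = Wd)
    (qd : ℚ) (hqd : shaAn Wd = (qd : ℂ)) :
    W.ShaFinite ∧ Wd.ShaFinite ∧ (W.baseChange K).ShaFinite ∧ (W.baseChange K).mordellWeilRank = 1 ∧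
      (∀ P : (W.baseChange K).toAffine.Point, 2 • P = 0 → P = 0) ∧ Wd.analyticRank = 0 ∧ padicValNat 2 W.shaOrder = 0 ∧
      ∃ qW : ℚ, shaAn W = (qW : ℂ) ∧ qW ≠ 0 ∧ qd ≠ 0 ∧
        padicValRat 2 qW + padicValRat 2 qd + (padicValNat 2 (W.baseChange K).shaOrder : ℤ) =
          2 * (padicValNat 2 (AddSubgroup.zmultiples P₀).index : ℤ) - 2 * (padicValInt 2 Dt.c : ℤ)
            - 2 * (padicValNat 2 W.tamagawaProduct : ℤ) + (padicValNat 2 W.shaOrder : ℤ) + (padicValNat 2 Wd.shaOrder : ℤ) := by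
  haveI : Fact (Nat.Prime 2) := ⟨Nat.prime_two⟩
  haveI hEK : (W.baseChange K).IsElliptic := isElliptic_baseChange' W K
  have h2 : Module.finrank ℚ K = 2 := hK.1
  have hD0 : (NumberField.discr K : ℚ) ≠ 0 := by exact_mod_cast NumberField.discr_ne_zero K
  haveI hEt : (W.quadraticTwist (NumberField.discr K : ℚ)).IsElliptic := W.isElliptic_quadraticTwist hD0
  obtain ⟨-, hDlt⟩ := discr_emod_four_and_lt_of_odd hK hodd h3
  have hw2 : Units.torsionOrder K = 2 :=
    Literature.NumberTheory.QuadraticFields.Quadratic.torsionOrder_eq_two_of_discr_lt_neg_four h2 hDlt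
  obtain ⟨Cd, hCd⟩ := hWd
  -- the Heegner point below `P(1)` IS `P₀`
  obtain ⟨P₁, Hd, hP₁, hP₁K⟩ := exists_heegnerPoint_map_eq_derivedPoint_one hK hH d₁
  obtain rfl : P₀ = P₁ :=
    WeierstrassCurve.Affine.Point.map_injective (W' := W) (algebraMap K (ringClassField K ι 1)).toRatAlgHom (hP₀K.trans hP₁K.symm)
  -- ranks over `ℚ` (GZK), `E(ℚ)[2] = 0`, `Ш(E)[2^∞] = 0` (`#Sel₂ = 2`), no `2`-torsion over `K`
  obtain ⟨hrankW, hfinW⟩ := hGZK W (by rw [hr])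
  have hrk : 1 ≤ W.mordellWeilRank := by rw [hrankW, hr]
  obtain ⟨-, hT2, hSha0⟩ := rank_eq_one_and_sha_primary_eq_zero_of_natCard_selmerGroup_eq_two W hSel hrk
  have hT2' : ∀ P : W.toAffine.Point, 2 • P = 0 → P = 0 := fun P hP ↦ by convert hT2 P (by convert hP)
  have hiv : ∀ x : (W.baseChange K).toAffine.Point, 2 • x = 0 → x = 0 := fun x hx ↦
    forall_two_zsmul_baseChange_eq_zero_of_heegner W K hK hodd hH hT2' x (by rw [← natCast_zsmul] at hx; exact_mod_cast hx)
  -- analytic ranks: `r_an(E^(d_K)) = 0`, `r_an(E_K) = 1`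
  have hrt : (W.quadraticTwist (NumberField.discr K : ℚ)).analyticRank = 0 :=
    analyticRank_twist_eq_zero_of_rankOne W K hGZ hmod hK hH hr ⟨Dt, Hd, ι, hP₁⟩ hPinf
  have hrd : Wd.analyticRank = 0 := by rw [← hCd, analyticRank_smul, hrt]
  have hrK : (W.baseChange K).analyticRank = 1 :=
    (P2.analyticRank_baseChange_eq_one_iff W K hmod h2).mpr (Or.inl ⟨hr, hrt⟩)
  obtain ⟨-, hfinD⟩ := hGZK Wd (by rw [hrd]; exact zero_le_one)
  -- Gross–Zagier over `K`
  obtain ⟨hrkK, hShaK, -, hshaC⟩ := shaAnOverC_baseChange_eq_of_heegner W K Dt Hd ι P₀ hGZ hGZK hmod hK hH hP₁ hc0 hrK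
  haveI : Finite (W.baseChange K).sha := hShaK
  haveI : Finite W.sha := hfinW
  haveI : Finite Wd.sha := hfinD
  -- Milne on the canonical model: `#Ш_an(E) = q·#Ш(E)·#Ш(Wd)/(qd·#Ш(E_K))`
  obtain ⟨-, hWR⟩ := hMilneC W K h2 Wd ⟨Cd, hCd⟩ (W.baseChange K) ⟨1, one_smul _ _⟩ hfinW hfinD
  set I := (AddSubgroup.zmultiples P₀).index with hI_def
  set q : ℚ := 4 * (I : ℚ) ^ 2 / ((Dt.c : ℚ) ^ 2 * (Units.torsionOrder K : ℚ) ^ 2 * ((W.tamagawaProduct : ℚ) ^ 2)) with hq_def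
  have hshaW := exists_shaAn_eq_of_overC W K Wd (W.baseChange K) hmod h2 ⟨Cd, hCd⟩ ⟨1, one_smul _ _⟩ hfinW hfinD hShaK hWR hshaC hqd
  set qW : ℚ := q * W.shaOrder * Wd.shaOrder / (qd * (W.baseChange K).shaOrder) with hqW_def
  -- non-vanishing
  have hI0 : I ≠ 0 := fun hI ↦ by
    have hh := P2.torsionOrder_sq_mul_canonicalHeight_eq_index_sq_mul_regulator (W.baseChange K) hrkK P₀ hPinf
    rw [← hI_def, hI, Nat.cast_zero, zero_pow two_ne_zero, zero_mul, mul_eq_zero, pow_eq_zero_iff two_ne_zero,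
      Nat.cast_eq_zero] at hh
    exact hh.elim (W.baseChange K).torsionOrder_pos_holds.ne'
      (fun h0 ↦ hPinf ((Affine.Point.canonicalHeight_eq_zero_iff_holds P₀).mp h0))
  have hcQ0 : (Dt.c : ℚ) ≠ 0 := by exact_mod_cast hc0
  have hC0 : W.tamagawaProduct ≠ 0 := W.tamagawaProduct_pos_holds.ne'
  have hcW0 : (W.tamagawaProduct : ℚ) ≠ 0 := by exact_mod_cast hC0
  have hIQ0 : (I : ℚ) ≠ 0 := by exact_mod_cast hI0
  have hsW0 : W.shaOrder ≠ 0 := (W.shaOrder_pos hfinW).ne'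
  have hsD0 : Wd.shaOrder ≠ 0 := (Wd.shaOrder_pos hfinD).ne'
  have hsK0 : (W.baseChange K).shaOrder ≠ 0 := ((W.baseChange K).shaOrder_pos hShaK).ne'
  have hqd0 : qd ≠ 0 := by
    intro h0
    exact shaAn_ne_zero Wd hmod (by rw [hqd, h0, Rat.cast_zero])
  have hqI : q = ((I : ℚ) / ((Dt.c : ℚ) * (W.tamagawaProduct : ℚ))) ^ 2 := by
    rw [hq_def, hw2]
    push_cast
    field_simp
    ring
  have hq0 : q ≠ 0 := by rw [hqI]; exact pow_ne_zero 2 (div_ne_zero hIQ0 (mul_ne_zero hcQ0 hcW0))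
  have hqW0 : qW ≠ 0 := by
    rw [hqW_def]
    exact div_ne_zero (mul_ne_zero (mul_ne_zero hq0 (by exact_mod_cast hsW0)) (by exact_mod_cast hsD0))
      (mul_ne_zero hqd0 (by exact_mod_cast hsK0))
  -- valuations
  have hvalq : padicValRat 2 q = 2 * (padicValNat 2 I : ℤ) - 2 * (padicValInt 2 Dt.c : ℤ) - 2 * (padicValNat 2 W.tamagawaProduct : ℤ) := by
    rw [hqI, padicValRat.pow, padicValRat.div hIQ0 (mul_ne_zero hcQ0 hcW0), padicValRat.mul hcQ0 hcW0, padicValRat.of_int,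
      padicValRat.of_nat, padicValRat.of_nat]
    push_cast
    ring
  have hvalqW : padicValRat 2 qW = padicValRat 2 q + (padicValNat 2 W.shaOrder : ℤ) + (padicValNat 2 Wd.shaOrder : ℤ)
      - (padicValRat 2 qd + (padicValNat 2 (W.baseChange K).shaOrder : ℤ)) := by
    rw [hqW_def, padicValRat.div (mul_ne_zero (mul_ne_zero hq0 (by exact_mod_cast hsW0)) (by exact_mod_cast hsD0))
      (mul_ne_zero hqd0 (by exact_mod_cast hsK0)), padicValRat.mul (mul_ne_zero hq0 (by exact_mod_cast hsW0)) (by exact_mod_cast hsD0),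
      padicValRat.mul hq0 (by exact_mod_cast hsW0), padicValRat.mul hqd0 (by exact_mod_cast hsK0), padicValRat.of_nat, padicValRat.of_nat,
      padicValRat.of_nat]
  -- `ord₂ #Ш(E) = 0`
  have hShaW0 : padicValNat 2 W.shaOrder = 0 := by
    rw [X11b.Three.Koly.padicValNat_shaOrder_eq W 2]
    have h1 : Nat.card (AddCommGroup.primaryComponent (↥W.sha) 2) = 1 := by
      rw [Nat.card_eq_one_iff_unique]
      exact ⟨⟨fun x y ↦ Subtype.ext ((hSha0 x.1 x.2).trans (hSha0 y.1 y.2).symm)⟩, ⟨0⟩⟩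
    rw [h1]
    simp
  refine ⟨hfinW, hfinD, hShaK, hrkK, hiv, hrd, hShaW0, qW, ?_, hqW0, hqd0, ?_⟩
  · rw [hqW_def]; exact_mod_cast hshaW
  · rw [hvalqW, hvalq]
    ring

/-! ## §2 B2″ — the `t′`-free swapped ledger at a frame where `y_K` is `2`-indivisible -/

/-- **B2″ (the swapped ledger WITHOUT the twin's Tamagawa term), PROVED modulo PRINT.**  In the setting of `swappedLedger` with `Dt.c` odd and
`P₀ ∉ 2E(K)` (the clause Kriz–Li's (★) delivers; `P₀` of infinite order follows): **`ord₂ #Ш_an(E) + ord₂ #Ш_an(Wd) ≤ −2·ord₂ C(E) ≤ 0`**.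
(`ord₂ I = 0` from `P₀ ∉ 2E(K)`; `ord₂ #Ш(E) = 0`; `ord₂ #Ш(Wd) ≤ ord₂ #Ш(E_K)` by `padicValNat_shaOrder_twist_le`.)  This is LINE 31's /
LINE 30's stub B2′ `stub_swappedLedger` with the term `+ ord₂ C(W')` of the rank-zero partner REMOVED (read `W ↦ Wd`, `K ↦ K'`, `Wd ↦ W'`,
`qd ↦ q'`): the Gross–Zagier–Milne ledger carries the Tamagawa product of the curve that owns the Heegner point (`C(Wd) = 1` in `2`-adic valuation
on K₁⁺, `= 2` on K₁⁻), never that of the partner.  CONDITIONAL on the four named facts; nothing about BSD is proved.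
[cite: GrossZagier1986, V.§2 (2.2)] [cite: Milne1972ArithmeticAV, §1 Thm. 1] [cite: Kramer1981, proof of Thm. 2] [cite: KrizLi2019, Lemma 5.4 (FMS)] -/
theorem swappedLedger_tfree
    (W : WeierstrassCurve ℚ) [W.IsElliptic] [W.IsGloballyMinimal] [NeZero (W.conductorNorm ℤ)]
    (K : Type) [Field K] [NumberField K]
    (hGZ : gross_zagier (W.conductorNorm ℤ) W K) (hGZK : rank_eq_analyticRank_of_analyticRank_le_one)
    (hmod : hasEntireLFunction_rat) (hMilneC : Milne1972.bsdQuotient_baseChange_quadratic_anyModel)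
    (hr : W.analyticRank = 1) (hSel : Nat.card (W.selmerGroup 2) = 2)
    (hK : IsImaginaryQuadratic K) (hodd : Odd (NumberField.discr K)) (h3 : NumberField.discr K ≠ -3)
    (hH : SatisfiesHeegnerHypothesis (W.conductorNorm ℤ) K)
    (Dt : ModularParametrizationData W (W.conductorNorm ℤ)) (hc : Odd Dt.c) (β : ℤ) (ι : K →+* ℂ)
    (d₁ : KolyvaginHeegnerData Dt β ι 1) (P₀ : (W.baseChange K).toAffine.Point)
    (hP₀K : WeierstrassCurve.Affine.Point.map (W' := W) (algebraMap K (ringClassField K ι 1)).toRatAlgHom P₀ = d₁.derivedPoint)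
    (hnd : ¬ ∃ Q : (W.baseChange K).toAffine.Point, (2 : ℤ) • Q = P₀)
    (Wd : WeierstrassCurve ℚ) [Wd.IsElliptic] [Wd.IsGloballyMinimal]
    (hWd : ∃ C : VariableChange ℚ, C • W.quadraticTwist (NumberField.discr K : ℚ) = Wd)
    (qd : ℚ) (hqd : shaAn Wd = (qd : ℂ)) :
    ∃ qW : ℚ, shaAn W = (qW : ℂ) ∧ padicValRat 2 qW + padicValRat 2 qd ≤ -2 * (padicValNat 2 W.tamagawaProduct : ℤ) := by
  haveI : Fact (Nat.Prime 2) := ⟨Nat.prime_two⟩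
  haveI hEK : (W.baseChange K).IsElliptic := isElliptic_baseChange' W K
  have h2 : Module.finrank ℚ K = 2 := hK.1
  have hc0 : Dt.c ≠ 0 := by
    obtain ⟨k, hk⟩ := hc
    omega
  -- `E(K)[2] = 0` (GZK rank + `#Sel₂ = 2`), so `P₀ ∉ 2E(K)` forces `P₀` of infinite order
  obtain ⟨hrankW, -⟩ := hGZK W (by rw [hr])
  have hrk : 1 ≤ W.mordellWeilRank := by rw [hrankW, hr]
  obtain ⟨-, hT2, -⟩ := rank_eq_one_and_sha_primary_eq_zero_of_natCard_selmerGroup_eq_two W hSel hrk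
  have hT2' : ∀ P : W.toAffine.Point, 2 • P = 0 → P = 0 := fun P hP ↦ by convert hT2 P (by convert hP)
  have hiv : ∀ x : (W.baseChange K).toAffine.Point, 2 • x = 0 → x = 0 := fun x hx ↦
    forall_two_zsmul_baseChange_eq_zero_of_heegner W K hK hodd hH hT2' x (by rw [← natCast_zsmul] at hx; exact_mod_cast hx)
  have hPinf : ¬ IsOfFinAddOrder P₀ := by
    intro hfin
    obtain ⟨t', ht'⟩ := X11b.LocalIndex.mem_range_nsmul_pow_of_isOfFinAddOrder hiv 1 hfin
    rw [nsmulAddMonoidHom_apply, pow_one] at ht'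
    exact hnd ⟨t', by exact_mod_cast ht'⟩
  obtain ⟨hfinW, hfinD, hShaK, hrkK, -, -, hShaW0, qW, hqW, -, -, hledger⟩ := swappedLedger W K hGZ hGZK hmod hMilneC hr hSel hK hodd h3
    hH Dt hc0 β ι d₁ P₀ hP₀K hPinf Wd hWd qd hqd
  -- `ord₂ I = 0`
  have hI : padicValNat 2 (AddSubgroup.zmultiples P₀).index = 0 := by
    by_contra hne
    exact hnd (exists_two_zsmul_eq_of_one_le_padicValNat_index (W.baseChange K) hrkK hiv P₀ hPinf (Nat.one_le_iff_ne_zero.mpr hne))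
  have hvc : padicValInt 2 Dt.c = 0 :=
    padicValInt.eq_zero_of_not_dvd (fun h2c ↦ (Int.not_even_iff_odd.mpr hc) (even_iff_two_dvd.mpr h2c))
  -- the twin's `Ш` is no bigger than `Ш(E_K)` in `2`-adic valuation
  have hle := padicValNat_shaOrder_twist_le W K h2 Wd hWd hrkK hiv hfinD hShaK
  refine ⟨qW, hqW, ?_⟩
  rw [hI, hvc, hShaW0] at hledger
  have hle' : (padicValNat 2 Wd.shaOrder : ℤ) ≤ (padicValNat 2 (W.baseChange K).shaOrder : ℤ) := by exact_mod_cast hle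
  simp only [Nat.cast_zero, mul_zero, sub_zero, add_zero] at hledger
  linarith

/-- **B2′ AS TYPED ⟸ B2″ + «the TWIN's Tamagawa valuation is bounded by twice the BASE's».**  In particular on LINE 31 (K₁⁺: the Heegner-carrying
curve has ODD Tamagawa product) B2′'s extra term `+ ord₂ C(W')` is justified exactly when `ord₂ C(W') = 0`, i.e. when every prime of `d_(K')` is
SILENT for the twin (`c_q(W') = 1`); at an auxiliary frame with a transposition or identity prime the registered B2′ asserts MORE than the ledger
gives.  Pure arithmetic on `swappedLedger_tfree`.  [cite: GrossZagier1986, V.§2 (2.2)] [cite: Milne1972ArithmeticAV, §1 Thm. 1] -/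
theorem swappedLedger_asTyped_of_tamagawa_le
    (W : WeierstrassCurve ℚ) [W.IsElliptic] [W.IsGloballyMinimal] [NeZero (W.conductorNorm ℤ)]
    (K : Type) [Field K] [NumberField K]
    (hGZ : gross_zagier (W.conductorNorm ℤ) W K) (hGZK : rank_eq_analyticRank_of_analyticRank_le_one)
    (hmod : hasEntireLFunction_rat) (hMilneC : Milne1972.bsdQuotient_baseChange_quadratic_anyModel)
    (hr : W.analyticRank = 1) (hSel : Nat.card (W.selmerGroup 2) = 2)
    (hK : IsImaginaryQuadratic K) (hodd : Odd (NumberField.discr K)) (h3 : NumberField.discr K ≠ -3)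
    (hH : SatisfiesHeegnerHypothesis (W.conductorNorm ℤ) K)
    (Dt : ModularParametrizationData W (W.conductorNorm ℤ)) (hc : Odd Dt.c) (β : ℤ) (ι : K →+* ℂ)
    (d₁ : KolyvaginHeegnerData Dt β ι 1) (P₀ : (W.baseChange K).toAffine.Point)
    (hP₀K : WeierstrassCurve.Affine.Point.map (W' := W) (algebraMap K (ringClassField K ι 1)).toRatAlgHom P₀ = d₁.derivedPoint)
    (hnd : ¬ ∃ Q : (W.baseChange K).toAffine.Point, (2 : ℤ) • Q = P₀)
    (Wd : WeierstrassCurve ℚ) [Wd.IsElliptic] [Wd.IsGloballyMinimal]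
    (hWd : ∃ C : VariableChange ℚ, C • W.quadraticTwist (NumberField.discr K : ℚ) = Wd)
    (hDEF : padicValNat 2 Wd.tamagawaProduct ≤ 2 * padicValNat 2 W.tamagawaProduct)
    (qd : ℚ) (hqd : shaAn Wd = (qd : ℂ)) :
    ∃ qW : ℚ, shaAn W = (qW : ℂ) ∧ padicValRat 2 qW + padicValRat 2 qd + (padicValNat 2 Wd.tamagawaProduct : ℤ) ≤ 0 := by
  obtain ⟨qW, hqW, hle⟩ := swappedLedger_tfree W K hGZ hGZK hmod hMilneC hr hSel hK hodd h3 hH Dt hc β ι d₁ P₀ hP₀K hnd Wd hWd qd hqd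
  have hDEF' : (padicValNat 2 Wd.tamagawaProduct : ℤ) ≤ 2 * (padicValNat 2 W.tamagawaProduct : ℤ) := by exact_mod_cast hDEF
  exact ⟨qW, hqW, by linarith⟩

end Summit.BirchSwinnertonDyer.BirchSwinnertonDyer.Theorems.GenusExact.SuHalves.SwappedLedger

end
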